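import Summits.QuantumFields.YangMills.Theorems.LangevinControlUVFemtoCurvatureSkewnessCRatioTransportDefsD
import Summits.QuantumFields.YangMills.Theorems.LangevinControlUVFemtoCurvatureSkewnessCDominatedDescent

/-!
# Crux `FemtoCurvatureSkewnessC` (stmt-QuantumFields-16205), line `ratio-transport`: the M-adic two-ended descent

Lead `prover-line-stmt-QuantumFields-16205-c1-0` (line lead, cycle 2, 2026-08-16).  Companion proof file of the vocabulary (D)
`LangevinControlUVFemtoCurvatureSkewnessCRatioTransportDefsD.lean` (`CutoffTwoEnded`, `CutoffEngineTE`).  Theorems only, no `sorry`, nothing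
posited.  Pure real analysis over the landed chains (`sep_chain`, `vol_chain`, p123392) and transfer lemmas (`guard_of_dominated`, p125209);
no property of `skewRatioT` is used.

* `madic_split` — the bookkeeping `k := log_M ⌊n/N₀⌋`, `n₀ := ⌊n/M^k⌋` for any block factor `M ≥ 2`:
  `M^k ≤ n < M^{k+1} N₀`, `1 ≤ n₀ < M N₀`, `k = 0 ∨ N₀ ≤ n₀`, `M^k n₀ ≤ n < M^k n₀ + M^k`.
* `ratioFloor_of_twoEnded` — **the descent in its weakest form**: fixed-torus anchors + the TWO-ENDED cutoff transport along the `M`-adic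
  chains of ANY continuous positive map `a` dominated by `a₀` + volume / separation transport in `a₀`'s femto boxes ⇒ a ratio floor in
  `a₀`'s femto boxes.  Same architecture as the landed dyadic descents (p124004 one map, p125209 two maps): (S) `n ↦ M^k n₀`, (V1)
  `L ↦ M^k⌊L/M^k⌋`, (V2) aspect ratio `↦ M^k K₀ n₀` — all at fixed `β` in `a₀`'s box; (C) ONE application of the two-ended transport between
  the fine point `(M^k B, β, M^k n₀)` and the coarse point `(B, β', n₀)`, `a β' = M^k a β`, `β' ∈ [β_ref, β]` by the intermediate value
  theorem for `a` (for `k = 0` the two points coincide and nothing is used); (A) the uniform anchor on the finite family `1 ≤ n₀ < M N₀`,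
  `8 n₀ ≤ B ≤ K₀ n₀`.
-/

set_option autoImplicit false

noncomputable section

namespace Summit.QuantumFields.YangMills.Cruxes.FemtoCurvatureSkewnessC.RatioTransport

open MeasureTheory Filter Topology
open scoped BigOperators
open Literature.MathematicalPhysics.QuantumFieldTheory

/-! ## M-adic bookkeeping -/

/-- M-adic bookkeeping of the separation: `k := log_M ⌊n/N₀⌋`, `n₀ := ⌊n/M^k⌋`, any block factor `M ≥ 2`. -/
theorem madic_split {M N₀ n k n₀ : ℕ} (hM : 2 ≤ M) (hN₀ : 1 ≤ N₀) (hn : 1 ≤ n) (hk : k = Nat.log M (n / N₀))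
    (hn₀ : n₀ = n / M ^ k) :
    M ^ k ≤ n ∧ n < M ^ (k + 1) * N₀ ∧ 1 ≤ n₀ ∧ n₀ < M * N₀ ∧ (k = 0 ∨ N₀ ≤ n₀) ∧
      M ^ k * n₀ ≤ n ∧ n < M ^ k * n₀ + M ^ k := by
  have hM1 : 1 < M := hM
  have hMk : 0 < M ^ k := Nat.pow_pos (by omega)
  have hN₀pos : 0 < N₀ := hN₀
  have hA : M ^ k ≤ n ∧ n < M ^ (k + 1) * N₀ ∧ (k = 0 ∨ N₀ * M ^ k ≤ n) := by
    by_cases hnN : n < N₀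
    · have h0 : n / N₀ = 0 := Nat.div_eq_of_lt hnN
      have hk0 : k = 0 := by rw [hk, h0, Nat.log_zero_right]
      subst hk0
      refine ⟨by simpa using hn, ?_, Or.inl rfl⟩
      calc n < N₀ := hnN
        _ ≤ M ^ (0 + 1) * N₀ := by rw [zero_add, pow_one]; exact Nat.le_mul_of_pos_left N₀ (by omega)
    · have hle : N₀ ≤ n := not_lt.1 hnN
      have hm : n / N₀ ≠ 0 := (Nat.div_pos hle hN₀pos).ne'
      have h1 : M ^ k ≤ n / N₀ := hk ▸ Nat.pow_log_le_self M hm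
      have h2 : n / N₀ < M ^ (k + 1) := hk ▸ Nat.lt_pow_succ_log_self hM1 _
      have h3 : M ^ k * N₀ ≤ n := (Nat.le_div_iff_mul_le hN₀pos).1 h1
      refine ⟨h1.trans (Nat.div_le_self _ _), ?_, Or.inr (by simpa [Nat.mul_comm] using h3)⟩
      have h4 : n < n / N₀ * N₀ + N₀ := Nat.lt_div_mul_add hN₀pos
      calc n < n / N₀ * N₀ + N₀ := h4
        _ = (n / N₀ + 1) * N₀ := by ring
        _ ≤ M ^ (k + 1) * N₀ := Nat.mul_le_mul_right _ h2
  obtain ⟨h1, h2, h3⟩ := hA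
  have hn₀1 : 1 ≤ n₀ := by
    rw [hn₀]; exact (Nat.le_div_iff_mul_le hMk).2 (by simpa using h1)
  have hn₀lt : n₀ < M * N₀ := by
    rw [hn₀]; apply (Nat.div_lt_iff_lt_mul hMk).2
    calc n < M ^ (k + 1) * N₀ := h2
      _ = M * N₀ * M ^ k := by ring
  have hdich : k = 0 ∨ N₀ ≤ n₀ := by
    rcases h3 with h | h
    · exact Or.inl h
    · right; rw [hn₀]; exact (Nat.le_div_iff_mul_le hMk).2 h
  have h5 : M ^ k * n₀ ≤ n := by rw [hn₀]; exact Nat.mul_div_le n (M ^ k)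
  have h6 : n < M ^ k * n₀ + M ^ k := by
    rw [hn₀]
    have := Nat.lt_div_mul_add (a := n) hMk
    linarith [Nat.mul_comm (n / M ^ k) (M ^ k)]
  exact ⟨h1, h2, hn₀1, hn₀lt, hdich, h5, h6⟩

section Descent

variable {G : Type} [Group G] [TopologicalSpace G] [IsTopologicalGroup G] [CompactSpace G]
  [MeasurableSpace G] [BorelSpace G]

/-- **The descent in its weakest form (two-ended cutoff transport, block factor `M ≥ 2`, dominated chain map).** -/
theorem ratioFloor_of_twoEnded (r : LatticeRep G) (a a₀ : ℝ → ℝ) {M : ℕ} (hM : 2 ≤ M)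
    (hpos : ∀ β, 0 < a β) (hcont : Continuous a) (hpos₀ : ∀ β, 0 < a₀ β) (hdom : Dominated a a₀)
    (hA : FixedTorusAnchors r) (hc : CutoffTwoEnded r a M) (hv : VolumeTransport r a₀) (hs : SeparationTransport r a₀) :
    RatioFloor r a₀ := by
  obtain ⟨u₀, hu₀, hAev⟩ := hA
  obtain ⟨βv, ℓv, CV₀, hℓv, hvol₀⟩ := hv
  obtain ⟨βs, ℓs, CS₀, hℓs, hsep₀⟩ := hs
  obtain ⟨K, β₃, hK, hKβ⟩ := hdom
  -- the two-ended cutoff transport at tolerance `u₀/8`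
  obtain ⟨βc, ℓc, N₁, hℓc, hN₁, hTE⟩ := hc (u₀ / 8) (by positivity)
  have hM1 : 1 < M := hM
  have hMpos : 0 < M := by omega
  -- WLOG the transport constants are nonnegative
  set CV : ℝ := max CV₀ 0 with hCVdef
  set CS : ℝ := max CS₀ 0 with hCSdef
  have hCV : 0 ≤ CV := le_max_right _ _
  have hCS : 0 ≤ CS := le_max_right _ _
  have hvol : ∀ (L L' : ℕ) [NeZero L] [NeZero L'] (β : ℝ) (n : ℕ), βv ≤ β → (L : ℝ) * a₀ β ≤ ℓv →
      1 ≤ n → 8 * n ≤ L' → L' ≤ L → L ≤ 2 * L' →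
        |skewRatioT r L β n - skewRatioT r L' β n| ≤ CV * ((n : ℝ) / L') ^ 4 * (((L : ℝ) - L') / L') := by
    intro L L' _ _ β n hβ hL hn h8 hle h2
    refine (hvol₀ L L' β n hβ hL hn h8 hle h2).trans ?_
    have hL'pos : (0 : ℝ) < L' := by exact_mod_cast (show 0 < L' by omega)
    have hX : 0 ≤ ((n : ℝ) / L') ^ 4 * (((L : ℝ) - L') / L') :=
      mul_nonneg (by positivity) (div_nonneg (by rw [sub_nonneg]; exact_mod_cast hle) hL'pos.le)
    calc CV₀ * ((n : ℝ) / L') ^ 4 * (((L : ℝ) - L') / L')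
        = CV₀ * (((n : ℝ) / L') ^ 4 * (((L : ℝ) - L') / L')) := by ring
      _ ≤ CV * (((n : ℝ) / L') ^ 4 * (((L : ℝ) - L') / L')) := mul_le_mul_of_nonneg_right (le_max_left _ _) hX
      _ = CV * ((n : ℝ) / L') ^ 4 * (((L : ℝ) - L') / L') := by ring
  have hsep : ∀ (L : ℕ) [NeZero L] (β : ℝ) (n : ℕ), βs ≤ β → (L : ℝ) * a₀ β ≤ ℓs →
      1 ≤ n → 8 * (n + 1) ≤ L → |skewRatioT r L β (n + 1) - skewRatioT r L β n| ≤ CS / n := by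
    intro L _ β n hβ hL hn h8
    exact (hsep₀ L β n hβ hL hn h8).trans (div_le_div_of_nonneg_right (le_max_left _ _) (by positivity))
  -- the budgets: `N₀` (two-ended threshold, separation, rounding) and `K₀` (aspect ratio)
  obtain ⟨N₂, hN₂⟩ := exists_nat_ge (8 * (CS + CV) / u₀)
  obtain ⟨N₀, hN₀def⟩ : ∃ N₀ : ℕ, N₀ = max N₁ N₂ := ⟨_, rfl⟩
  have hN₀1 : 1 ≤ N₀ := hN₀def ▸ le_trans hN₁ (le_max_left _ _)
  have hN₁N₀ : N₁ ≤ N₀ := hN₀def ▸ le_max_left _ _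
  have hN₀pos : (0 : ℝ) < N₀ := by exact_mod_cast hN₀1
  have hbudgetN : (CS + CV) / N₀ ≤ u₀ / 8 := by
    have h1 : 8 * (CS + CV) / u₀ ≤ N₀ := hN₂.trans (by rw [hN₀def]; exact_mod_cast le_max_right N₁ N₂)
    rw [div_le_iff₀ hu₀] at h1
    rw [div_le_iff₀ hN₀pos]
    linarith
  obtain ⟨K₂, hK₂⟩ := exists_nat_ge (16 * CV / u₀)
  obtain ⟨K₀, hK₀def⟩ : ∃ K₀ : ℕ, K₀ = max 8 K₂ := ⟨_, rfl⟩
  have hK₀8 : 8 ≤ K₀ := hK₀def ▸ le_max_left _ _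
  have hK₀pos : (0 : ℝ) < K₀ := by exact_mod_cast (show 0 < K₀ by omega)
  have hbudgetK : 2 * CV / (K₀ : ℝ) ^ 4 ≤ u₀ / 8 := by
    have hK1 : (1 : ℝ) ≤ K₀ := by exact_mod_cast (show 1 ≤ K₀ by omega)
    have hK4 : (K₀ : ℝ) ≤ (K₀ : ℝ) ^ 4 := by
      calc (K₀ : ℝ) = (K₀ : ℝ) ^ 1 := (pow_one _).symm
        _ ≤ (K₀ : ℝ) ^ 4 := pow_le_pow_right₀ hK1 (by norm_num)
    have h1 : 16 * CV / u₀ ≤ K₀ := hK₂.trans (by rw [hK₀def]; exact_mod_cast le_max_right 8 K₂)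
    rw [div_le_iff₀ hu₀] at h1
    calc 2 * CV / (K₀ : ℝ) ^ 4 ≤ 2 * CV / K₀ := div_le_div_of_nonneg_left (by positivity) hK₀pos hK4
      _ ≤ u₀ / 8 := by rw [div_le_iff₀ hK₀pos]; linarith
  -- anchor thresholds on the finite family `n₀ < M N₀`, `L₀ ≤ M K₀ N₀`, majorised by one coupling `βA`
  have hT' : ∀ L₀ n₀ : ℕ, ∃ T : ℝ, ∀ β : ℝ, T ≤ β → 1 ≤ n₀ → 8 * n₀ ≤ L₀ →
      ∀ (_ : NeZero L₀), u₀ ≤ skewRatioT r L₀ β n₀ := by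
    intro L₀ n₀
    by_cases h : 1 ≤ n₀ ∧ 8 * n₀ ≤ L₀
    · haveI : NeZero L₀ := ⟨by omega⟩
      obtain ⟨T, hT⟩ := Filter.eventually_atTop.1 (hAev L₀ n₀ h.1 h.2)
      exact ⟨T, fun β hβ _ _ _ => hT β hβ⟩
    · exact ⟨0, fun β _ h1 h8 _ => (h ⟨h1, h8⟩).elim⟩
  choose T hT using hT'
  obtain ⟨βA, hβAdef⟩ : ∃ βA : ℝ,
      βA = ∑ n₀ ∈ Finset.range (M * N₀), ∑ L₀ ∈ Finset.range (M * K₀ * N₀ + 1), |T L₀ n₀| := ⟨_, rfl⟩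
  have hTle : ∀ L₀ n₀ : ℕ, n₀ < M * N₀ → L₀ < M * K₀ * N₀ + 1 → T L₀ n₀ ≤ βA := by
    intro L₀ n₀ hn hL
    rw [hβAdef]
    calc T L₀ n₀ ≤ |T L₀ n₀| := le_abs_self _
      _ ≤ ∑ L₀' ∈ Finset.range (M * K₀ * N₀ + 1), |T L₀' n₀| :=
          Finset.single_le_sum (f := fun L₀' => |T L₀' n₀|) (fun _ _ => abs_nonneg _) (Finset.mem_range.2 hL)
      _ ≤ ∑ n₀' ∈ Finset.range (M * N₀), ∑ L₀' ∈ Finset.range (M * K₀ * N₀ + 1), |T L₀' n₀'| :=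
          Finset.single_le_sum (f := fun n₀' => ∑ L₀' ∈ Finset.range (M * K₀ * N₀ + 1), |T L₀' n₀'|)
            (fun _ _ => Finset.sum_nonneg fun _ _ => abs_nonneg _) (Finset.mem_range.2 hn)
  -- the reference coupling and the femto thresholds of the floor
  obtain ⟨βref, hβrefdef⟩ : ∃ βref : ℝ, βref = max βA (max βc (max βv (max βs β₃))) := ⟨_, rfl⟩
  have hβA : βA ≤ βref := hβrefdef ▸ le_max_left _ _
  have hβc : βc ≤ βref := hβrefdef ▸ le_trans (le_max_left _ _) (le_max_right _ _)
  have hβv : βv ≤ βref :=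
    hβrefdef ▸ le_trans (le_trans (le_max_left _ _) (le_max_right _ _)) (le_max_right _ _)
  have hβs : βs ≤ βref :=
    hβrefdef ▸ le_trans (le_trans (le_trans (le_max_left _ _) (le_max_right _ _)) (le_max_right _ _)) (le_max_right _ _)
  have hβ₃ : β₃ ≤ βref :=
    hβrefdef ▸ le_trans (le_trans (le_trans (le_max_right _ _) (le_max_right _ _)) (le_max_right _ _)) (le_max_right _ _)
  obtain ⟨ℓ₁, hℓ₁def⟩ : ∃ ℓ₁ : ℝ, ℓ₁ = min (min (ℓc / K) (min ℓv ℓs)) (8 * a βref / K) := ⟨_, rfl⟩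
  have hℓ₁pos : 0 < ℓ₁ :=
    hℓ₁def ▸ lt_min (lt_min (div_pos hℓc hK) (lt_min hℓv hℓs)) (div_pos (by linarith [hpos βref]) hK)
  refine ⟨βref, ℓ₁, u₀ / 2, hℓ₁pos, by positivity, ?_⟩
  intro L _ β n hβ hL hn h8
  have hβ₃β : β₃ ≤ β := hβ₃.trans hβ
  have hLc : (L : ℝ) * a β ≤ ℓc :=
    guard_of_dominated hK hKβ hβ₃β (hL.trans (hℓ₁def ▸ (min_le_left _ _).trans (min_le_left _ _)))
  have hLv : (L : ℝ) * a₀ β ≤ ℓv :=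
    hL.trans (hℓ₁def ▸ (min_le_left _ _).trans ((min_le_right _ _).trans (min_le_left _ _)))
  have hLs : (L : ℝ) * a₀ β ≤ ℓs :=
    hL.trans (hℓ₁def ▸ (min_le_left _ _).trans ((min_le_right _ _).trans (min_le_right _ _)))
  have hL8a : (L : ℝ) * a β ≤ 8 * a βref :=
    guard_of_dominated hK hKβ hβ₃β (hL.trans (hℓ₁def ▸ min_le_right _ _))
  have haβ : 0 < a β := hpos β
  have ha₀β : 0 < a₀ β := hpos₀ β
  have hβcβ : βc ≤ β := hβc.trans hβ
  have hβvβ : βv ≤ β := hβv.trans hβ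
  have hβsβ : βs ≤ β := hβs.trans hβ
  -- M-adic decomposition of the separation and of the box
  obtain ⟨k, hkdef⟩ : ∃ k : ℕ, k = Nat.log M (n / N₀) := ⟨_, rfl⟩
  obtain ⟨n₀, hn₀def⟩ : ∃ n₀ : ℕ, n₀ = n / M ^ k := ⟨_, rfl⟩
  obtain ⟨hk_le_n, -, hn₀1, hn₀lt, hdich, hn'le, hnlt⟩ := madic_split hM hN₀1 hn hkdef hn₀def
  have h2k : 0 < M ^ k := Nat.pow_pos hMpos
  obtain ⟨L₀, hL₀def⟩ : ∃ L₀ : ℕ, L₀ = L / M ^ k := ⟨_, rfl⟩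
  have hL₀8 : 8 * n₀ ≤ L₀ := by
    rw [hL₀def]; apply (Nat.le_div_iff_mul_le h2k).2
    calc 8 * n₀ * M ^ k = 8 * (M ^ k * n₀) := by ring
      _ ≤ 8 * n := Nat.mul_le_mul_left 8 hn'le
      _ ≤ L := h8
  have hL'le : M ^ k * L₀ ≤ L := by rw [hL₀def]; exact Nat.mul_div_le L (M ^ k)
  have hLlt : L < M ^ k * L₀ + M ^ k := by
    rw [hL₀def]
    have := Nat.lt_div_mul_add (a := L) h2k
    linarith [Nat.mul_comm (L / M ^ k) (M ^ k)]
  have hL₀pos : 0 < L₀ := by omega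
  haveI hinstL' : NeZero (M ^ k * L₀) := ⟨(Nat.mul_pos h2k hL₀pos).ne'⟩
  obtain ⟨d, hd⟩ := Nat.exists_eq_add_of_le hn'le
  have hd_lt : d < M ^ k := by omega
  -- (S) separation: n ↦ M^k n₀ at fixed (L, β), inside `a₀`'s box
  have hS : |skewRatioT r L β (M ^ k * n₀ + d) - skewRatioT r L β (M ^ k * n₀)| ≤ CS / N₀ := by
    have h := sep_chain r a₀ hCS hsep L β hβsβ hLs (M ^ k * n₀) (Nat.mul_pos h2k (by omega)) d
      (by rw [← hd]; exact h8)
    refine h.trans ?_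
    rcases hdich with hk0 | hNn
    · subst hk0
      have hd0 : d = 0 := by
        have : d < M ^ 0 := hd_lt
        simpa using this
      subst hd0
      simp only [Nat.cast_zero, mul_zero, zero_div]
      positivity
    · have hn'pos : (0 : ℝ) < (M ^ k * n₀ : ℕ) := by exact_mod_cast Nat.mul_pos h2k (by omega)
      rw [div_le_div_iff₀ hn'pos hN₀pos]
      have h1 : (d : ℝ) ≤ (M : ℝ) ^ k := by exact_mod_cast hd_lt.le
      have h2 : (M : ℝ) ^ k * N₀ ≤ (M ^ k * n₀ : ℕ) := by
        push_cast; exact mul_le_mul_of_nonneg_left (by exact_mod_cast hNn) (by positivity)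
      calc CS * d * N₀ ≤ CS * (M : ℝ) ^ k * N₀ := by gcongr
        _ = CS * ((M : ℝ) ^ k * N₀) := by ring
        _ ≤ CS * (M ^ k * n₀ : ℕ) := mul_le_mul_of_nonneg_left h2 hCS
  -- (V1) rounding the box: L ↦ M^k ⌊L/M^k⌋ at fixed (β, M^k n₀), inside `a₀`'s box
  have hV1 : |skewRatioT r L β (M ^ k * n₀) - skewRatioT r (M ^ k * L₀) β (M ^ k * n₀)| ≤ CV / N₀ := by
    have hP : M ^ k ≤ M ^ k * L₀ := Nat.le_mul_of_pos_right _ hL₀pos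
    have h := hvol L (M ^ k * L₀) β (M ^ k * n₀) hβvβ hLv (Nat.mul_pos h2k (by omega))
      (by calc 8 * (M ^ k * n₀) = M ^ k * (8 * n₀) := by ring
            _ ≤ M ^ k * L₀ := Nat.mul_le_mul_left _ hL₀8) hL'le (by omega)
    refine h.trans ?_
    have hL'pos : (0 : ℝ) < (M ^ k * L₀ : ℕ) := by exact_mod_cast Nat.mul_pos h2k hL₀pos
    have hratio : ((M ^ k * n₀ : ℕ) : ℝ) / (M ^ k * L₀ : ℕ) ≤ 1 := by
      rw [div_le_one hL'pos]; exact_mod_cast (Nat.mul_le_mul_left (M ^ k) (by omega : n₀ ≤ L₀))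
    have hratio0 : 0 ≤ ((M ^ k * n₀ : ℕ) : ℝ) / (M ^ k * L₀ : ℕ) := by positivity
    have hpow : (((M ^ k * n₀ : ℕ) : ℝ) / (M ^ k * L₀ : ℕ)) ^ 4 ≤ 1 := pow_le_one₀ hratio0 hratio
    have hfrac0 : 0 ≤ ((L : ℝ) - (M ^ k * L₀ : ℕ)) / (M ^ k * L₀ : ℕ) :=
      div_nonneg (by rw [sub_nonneg]; exact_mod_cast hL'le) hL'pos.le
    rcases hdich with hk0 | hNn
    · subst hk0
      have hLL : M ^ 0 * L₀ = L := by simp [hL₀def]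
      have : ((L : ℝ) - (M ^ 0 * L₀ : ℕ)) / (M ^ 0 * L₀ : ℕ) = 0 := by
        rw [show ((M ^ 0 * L₀ : ℕ) : ℝ) = L by exact_mod_cast hLL]; simp
      rw [this, mul_zero]; positivity
    · have hfrac : ((L : ℝ) - (M ^ k * L₀ : ℕ)) / (M ^ k * L₀ : ℕ) ≤ 1 / N₀ := by
        rw [div_le_div_iff₀ hL'pos hN₀pos, one_mul]
        have h1 : (L : ℝ) - (M ^ k * L₀ : ℕ) ≤ (M : ℝ) ^ k := by
          have : (L : ℝ) < (M ^ k * L₀ : ℕ) + (M : ℝ) ^ k := by exact_mod_cast hLlt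
          linarith
        have h2 : (M : ℝ) ^ k * N₀ ≤ (M ^ k * L₀ : ℕ) := by
          push_cast
          exact mul_le_mul_of_nonneg_left (by exact_mod_cast hNn.trans (by omega : n₀ ≤ L₀)) (by positivity)
        calc ((L : ℝ) - (M ^ k * L₀ : ℕ)) * N₀ ≤ (M : ℝ) ^ k * N₀ := by gcongr
          _ ≤ (M ^ k * L₀ : ℕ) := h2
      calc CV * (((M ^ k * n₀ : ℕ) : ℝ) / (M ^ k * L₀ : ℕ)) ^ 4 * (((L : ℝ) - (M ^ k * L₀ : ℕ)) / (M ^ k * L₀ : ℕ))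
          ≤ CV * 1 * (1 / N₀) := by gcongr
        _ = CV / N₀ := by ring
  -- (V2) aspect ratio: M^k L₀ ↦ M^k B with B := min L₀ (K₀ n₀), inside `a₀`'s box
  obtain ⟨B, hB8, hBK, hBL₀, hV2⟩ : ∃ B : ℕ, 8 * n₀ ≤ B ∧ B ≤ K₀ * n₀ ∧ B ≤ L₀ ∧
      ∀ (i₂ : NeZero (M ^ k * B)),
        |skewRatioT r (M ^ k * L₀) β (M ^ k * n₀) - skewRatioT r (M ^ k * B) β (M ^ k * n₀)| ≤ u₀ / 8 := by
    by_cases hcase : L₀ ≤ K₀ * n₀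
    · refine ⟨L₀, hL₀8, hcase, le_rfl, fun i₂ => ?_⟩
      rw [sub_self, abs_zero]; positivity
    · have hlt : K₀ * n₀ < L₀ := not_le.1 hcase
      have hBpos : 0 < K₀ * n₀ := Nat.mul_pos (by omega) (by omega)
      refine ⟨K₀ * n₀, Nat.mul_le_mul_right _ hK₀8, le_rfl, hlt.le, fun i₂ => ?_⟩
      haveI : NeZero (M ^ k * (K₀ * n₀)) := ⟨(Nat.mul_pos h2k hBpos).ne'⟩
      have h := vol_chain r a₀ hCV hvol L β hβvβ hLv ha₀β (M ^ k * n₀) (Nat.mul_pos h2k (by omega))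
        (M ^ k * L₀ - M ^ k * (K₀ * n₀)) (M ^ k * (K₀ * n₀)) (M ^ k * L₀) le_rfl
        (by calc 8 * (M ^ k * n₀) = M ^ k * (8 * n₀) := by ring
              _ ≤ M ^ k * (K₀ * n₀) := Nat.mul_le_mul_left _ (Nat.mul_le_mul_right _ hK₀8))
        (Nat.mul_le_mul_left _ hlt.le) hL'le
      refine h.trans ?_
      have hMpos' : (0 : ℝ) < (M ^ k * (K₀ * n₀) : ℕ) := by exact_mod_cast Nat.mul_pos h2k hBpos
      have hq : ((M ^ k * n₀ : ℕ) : ℝ) / (M ^ k * (K₀ * n₀) : ℕ) = 1 / K₀ := by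
        rw [div_eq_div_iff hMpos'.ne' hK₀pos.ne', one_mul]
        push_cast; ring
      rw [hq]
      calc 2 * CV * (1 / (K₀ : ℝ)) ^ 4 = 2 * CV / (K₀ : ℝ) ^ 4 := by rw [one_div, inv_pow, div_eq_mul_inv]
        _ ≤ u₀ / 8 := hbudgetK
  have hBpos : 0 < B := by omega
  haveI hinstBk : NeZero (M ^ k * B) := ⟨(Nat.mul_pos h2k hBpos).ne'⟩
  haveI hinstB : NeZero B := ⟨hBpos.ne'⟩
  -- (C) the coarse coupling by the intermediate value theorem, for the DOMINATED map `a` (and `β' = β` when `k = 0`)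
  obtain ⟨β', hβ'ref, hβ'le, haβ', hβ'k⟩ : ∃ b : ℝ, βref ≤ b ∧ b ≤ β ∧ a b = (M : ℝ) ^ k * a β ∧ (k = 0 → b = β) := by
    by_cases hk : k = 0
    · exact ⟨β, hβ, le_rfl, by rw [hk, pow_zero, one_mul], fun _ => rfl⟩
    · have hlow : a β ≤ (M : ℝ) ^ k * a β :=
        le_mul_of_one_le_left haβ.le (one_le_pow₀ (by exact_mod_cast hM1.le))
      have hup : (M : ℝ) ^ k * a β ≤ a βref := by
        have h2 : (M : ℝ) ^ k ≤ n := by exact_mod_cast hk_le_n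
        have h3 : (8 : ℝ) * n ≤ L := by exact_mod_cast h8
        have h4 : 8 * (n : ℝ) * a β ≤ L * a β := mul_le_mul_of_nonneg_right h3 haβ.le
        calc (M : ℝ) ^ k * a β ≤ n * a β := mul_le_mul_of_nonneg_right h2 haβ.le
          _ ≤ a βref := by nlinarith [h4, hL8a]
      obtain ⟨b, ⟨hb1, hb2⟩, hab⟩ :=
        intermediate_value_Icc' hβ hcont.continuousOn ⟨hlow, hup⟩
      exact ⟨b, hb1, hb2, hab, fun h => (hk h).elim⟩
  have f4 : skewRatioT r B β' n₀ - skewRatioT r (M ^ k * B) β (M ^ k * n₀) ≤ u₀ / 8 := by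
    rcases hdich with hk0 | hNn
    · have hb : β' = β := hβ'k hk0
      subst hk0
      rw [hb]
      have e : skewRatioT r (M ^ 0 * B) β (M ^ 0 * n₀) = skewRatioT r B β n₀ := by
        have h1 : M ^ 0 * B = B := by rw [pow_zero, one_mul]
        have h2 : M ^ 0 * n₀ = n₀ := by rw [pow_zero, one_mul]
        simp only [h1, h2]
      rw [e, sub_self]; positivity
    · have hfemto : ((M ^ k * B : ℕ) : ℝ) * a β ≤ ℓc := by
        have h1 : ((M ^ k * B : ℕ) : ℝ) ≤ L := by exact_mod_cast (Nat.mul_le_mul_left _ hBL₀).trans hL'le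
        calc ((M ^ k * B : ℕ) : ℝ) * a β ≤ L * a β := by gcongr
          _ ≤ ℓc := hLc
      have h := hTE (M ^ k * B) B k n₀ β β' rfl (hN₁N₀.trans hNn) hB8 (hβc.trans hβ'ref) hβ'le hfemto haβ'
      exact (abs_sub_le_iff.1 h).2
  -- (A) the anchor at (B, β', n₀)
  have f5 : u₀ ≤ skewRatioT r B β' n₀ := by
    have h4 : B < M * K₀ * N₀ + 1 := by
      have h4' : B ≤ M * K₀ * N₀ := by
        calc B ≤ K₀ * n₀ := hBK
          _ ≤ K₀ * (M * N₀) := Nat.mul_le_mul_left K₀ hn₀lt.le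
          _ = M * K₀ * N₀ := by ring
      exact Nat.lt_succ_of_le h4'
    exact hT B n₀ β' ((hTle _ _ hn₀lt h4).trans (hβA.trans hβ'ref)) hn₀1 hB8 inferInstance
  -- assemble
  have f1 : skewRatioT r L β (M ^ k * n₀) - skewRatioT r L β (M ^ k * n₀ + d) ≤ CS / N₀ :=
    (abs_sub_le_iff.1 hS).2
  have f2 : skewRatioT r (M ^ k * L₀) β (M ^ k * n₀) - skewRatioT r L β (M ^ k * n₀) ≤ CV / N₀ :=
    (abs_sub_le_iff.1 hV1).2
  have f3 : skewRatioT r (M ^ k * B) β (M ^ k * n₀) - skewRatioT r (M ^ k * L₀) β (M ^ k * n₀) ≤ u₀ / 8 :=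
    (abs_sub_le_iff.1 (hV2 inferInstance)).2
  have hsumN : CS / N₀ + CV / N₀ ≤ u₀ / 8 := by rw [← add_div]; exact hbudgetN
  have lb : ∀ {x y l c : ℝ}, y - x ≤ c → l ≤ y → l - c ≤ x := fun h1 h2 => by linarith
  have g1 : u₀ - u₀ / 8 - u₀ / 8 - CV / N₀ - CS / N₀ ≤ skewRatioT r L β (M ^ k * n₀ + d) :=
    lb f1 (lb f2 (lb f3 (lb f4 f5)))
  have hfinal : u₀ / 2 ≤ u₀ - u₀ / 8 - u₀ / 8 - CV / N₀ - CS / N₀ := by linarith [hsumN, hu₀]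
  rw [hd]
  exact hfinal.trans g1

end Descent

end Summit.QuantumFields.YangMills.Cruxes.FemtoCurvatureSkewnessC.RatioTransport

end
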